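import Summits.BirchSwinnertonDyer.BirchSwinnertonDyer.Theorems.ManinLocalTwoThreeEulerRemaindersFiftySix
import HarnessLib

/-!
# The Euler functions at level 56, deeper: `E₂`, `E₄`, `E₈`, `E₁₄`, `E₂₈` modulo `o(q³⁴)` (coefficients `0, …, 17` of `∏(1 − Xⁿ)`)

Cell bsd-f2-manin, route `ManinLocalTwoThree` (crux C2 `ManinOddAtFour`, stmt-22967: `2² ∣ 56`), prover seat p2 gen 28; the depth needed by
the weight-`4` identity (K) of the `X₀(56) → 56b1` programme (`EtaLimitKFiftySix`: cuspidal Sturm bound `m = 26` in `S₄(Γ₀(56))`, numerator over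
`q⁸`, so `q`-expansions through `q³⁴`).  Same mechanism as `EulerRemaindersFiftySix` (the tree's formal pentagonal number theorem).
No definition, no named fact, no sorry; nothing here proves C2, Manin's conjecture or BSD. [cite: HardyWright2008, §19.9 Thm 353]
-/

set_option autoImplicit false
-- lint-debt: the directory name repeats the summit name (sibling precedent `ManinLocalTwoThreeEulerRemaindersFiftySix.lean`)
set_option linter.dupNamespace false

noncomputable section

open Complex Filter Topology Set Asymptotics Polynomial
open UpperHalfPlane hiding I
open scoped Real Topology Manifold MatrixGroups
open Literature.NumberTheory.EllipticCurves Literature.NumberTheory.EllipticCurves.ModularForms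

namespace Summit.BirchSwinnertonDyer.BirchSwinnertonDyer.Theorems.ManinLocalTwoThree.EulerRemaindersFiftySixB

open QRemainder EulerRemainders

/-- The coefficients `0, …, 17` of `∏_{n ≥ 1} (1 − Xⁿ)` (pentagonal number theorem). [cite: HardyWright2008, §19.9 Thm 353] -/
theorem coeff_formalEulerPow_one_le_seventeen (n : ℕ) (hn : n ≤ 17) :
    PowerSeries.coeff n (formalEulerPow 1)
      = if n = 0 then 1 else if n = 1 then -1 else if n = 2 then -1 else if n = 5 then 1 else if n = 7 then 1
        else if n = 12 then -1 else if n = 15 then -1 else 0 := by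
  rw [coeff_formalEulerPow hn, eulerTrunc]
  simp only [pow_one]
  rw [Literature.Combinatorics.Enumerative.EulerPentagonal.coeff_prod_one_sub_X_pow_eq_coeff_partialSum (R := ℤ) hn]
  simp only [Finset.sum_range_succ, Finset.sum_range_zero]
  norm_num
  interval_cases n <;> simp [PowerSeries.coeff_X]

/-- The `q`-coefficients `0, …, 34` of `E₂`. [folklore] -/
theorem coeff_formalEulerScaled_two_le_thirtyFour (n : ℕ) (hn : n ≤ 34) :
    PowerSeries.coeff n (formalEulerScaled 2) = if n = 0 then 1 else if n = 2 then -1 else if n = 4 then -1 else if n = 10 then 1 else if n = 14 then 1 else if n = 24 then -1 else if n = 30 then -1 else 0 := by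
  have h0 := coeff_formalEulerPow_one_le_seventeen 0 (by norm_num) 
  have h1 := coeff_formalEulerPow_one_le_seventeen 1 (by norm_num) 
  have h2 := coeff_formalEulerPow_one_le_seventeen 2 (by norm_num) 
  have h3 := coeff_formalEulerPow_one_le_seventeen 3 (by norm_num) 
  have h4 := coeff_formalEulerPow_one_le_seventeen 4 (by norm_num) 
  have h5 := coeff_formalEulerPow_one_le_seventeen 5 (by norm_num) 
  have h6 := coeff_formalEulerPow_one_le_seventeen 6 (by norm_num) 
  have h7 := coeff_formalEulerPow_one_le_seventeen 7 (by norm_num) 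
  have h8 := coeff_formalEulerPow_one_le_seventeen 8 (by norm_num) 
  have h9 := coeff_formalEulerPow_one_le_seventeen 9 (by norm_num) 
  have h10 := coeff_formalEulerPow_one_le_seventeen 10 (by norm_num) 
  have h11 := coeff_formalEulerPow_one_le_seventeen 11 (by norm_num) 
  have h12 := coeff_formalEulerPow_one_le_seventeen 12 (by norm_num) 
  have h13 := coeff_formalEulerPow_one_le_seventeen 13 (by norm_num) 
  have h14 := coeff_formalEulerPow_one_le_seventeen 14 (by norm_num) 
  have h15 := coeff_formalEulerPow_one_le_seventeen 15 (by norm_num) 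
  have h16 := coeff_formalEulerPow_one_le_seventeen 16 (by norm_num) 
  have h17 := coeff_formalEulerPow_one_le_seventeen 17 (by norm_num)
  simp only at h0 h1 h2 h3 h4 h5 h6 h7 h8 h9 h10 h11 h12 h13 h14 h15 h16 h17
  interval_cases n <;> simp +decide [coeff_formalEulerScaled, h0, h1, h2, h3, h4, h5, h6, h7, h8, h9, h10, h11, h12, h13, h14, h15, h16, h17]

/-- **`E₂ = 1 - q ^ 2 - q ^ 4 + q ^ 10 + q ^ 14 - q ^ 24 - q ^ 30 + o(q³⁴)`.** [folklore] -/
theorem tendsto_eulerFn_two_thirtyFour :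
    Tendsto (fun τ : ℍ ↦ (eulerFn 2 τ - (1 - X ^ 2 - X ^ 4 + X ^ 10 + X ^ 14 - X ^ 24 - X ^ 30 : ℂ[X]).eval (Function.Periodic.qParam 1 (τ : ℂ)))
      / Function.Periodic.qParam 1 (τ : ℂ) ^ 34) atImInfty (𝓝 0) := by
  refine congr_poly ?_ (tendsto_of_hasSum (periodic_eulerFn 2) (mdifferentiable_eulerFn 2)
    (isBoundedAtImInfty_eulerFn (by norm_num)) (hasSum_eulerFn (by norm_num)) 34)
  have h := coeff_formalEulerScaled_two_le_thirtyFour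
  simp only [Finset.sum_range_succ, Finset.sum_range_zero, h 0 (by norm_num), h 1 (by norm_num), h 2 (by norm_num), h 3 (by norm_num), h 4 (by norm_num), h 5 (by norm_num), h 6 (by norm_num), h 7 (by norm_num), h 8 (by norm_num), h 9 (by norm_num), h 10 (by norm_num), h 11 (by norm_num), h 12 (by norm_num), h 13 (by norm_num), h 14 (by norm_num), h 15 (by norm_num), h 16 (by norm_num), h 17 (by norm_num), h 18 (by norm_num), h 19 (by norm_num), h 20 (by norm_num), h 21 (by norm_num), h 22 (by norm_num), h 23 (by norm_num), h 24 (by norm_num), h 25 (by norm_num), h 26 (by norm_num), h 27 (by norm_num), h 28 (by norm_num), h 29 (by norm_num), h 30 (by norm_num), h 31 (by norm_num), h 32 (by norm_num), h 33 (by norm_num), h 34 (by norm_num)]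
  norm_num
  ring

/-- The `q`-coefficients `0, …, 34` of `E₄`. [folklore] -/
theorem coeff_formalEulerScaled_four_le_thirtyFour (n : ℕ) (hn : n ≤ 34) :
    PowerSeries.coeff n (formalEulerScaled 4) = if n = 0 then 1 else if n = 4 then -1 else if n = 8 then -1 else if n = 20 then 1 else if n = 28 then 1 else 0 := by
  have h0 := coeff_formalEulerPow_one_le_seventeen 0 (by norm_num) 
  have h1 := coeff_formalEulerPow_one_le_seventeen 1 (by norm_num) 
  have h2 := coeff_formalEulerPow_one_le_seventeen 2 (by norm_num) 
  have h3 := coeff_formalEulerPow_one_le_seventeen 3 (by norm_num) 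
  have h4 := coeff_formalEulerPow_one_le_seventeen 4 (by norm_num) 
  have h5 := coeff_formalEulerPow_one_le_seventeen 5 (by norm_num) 
  have h6 := coeff_formalEulerPow_one_le_seventeen 6 (by norm_num) 
  have h7 := coeff_formalEulerPow_one_le_seventeen 7 (by norm_num) 
  have h8 := coeff_formalEulerPow_one_le_seventeen 8 (by norm_num)
  simp only at h0 h1 h2 h3 h4 h5 h6 h7 h8
  interval_cases n <;> simp +decide [coeff_formalEulerScaled, h0, h1, h2, h3, h4, h5, h6, h7, h8]

/-- **`E₄ = 1 - q ^ 4 - q ^ 8 + q ^ 20 + q ^ 28 + o(q³⁴)`.** [folklore] -/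
theorem tendsto_eulerFn_four_thirtyFour :
    Tendsto (fun τ : ℍ ↦ (eulerFn 4 τ - (1 - X ^ 4 - X ^ 8 + X ^ 20 + X ^ 28 : ℂ[X]).eval (Function.Periodic.qParam 1 (τ : ℂ)))
      / Function.Periodic.qParam 1 (τ : ℂ) ^ 34) atImInfty (𝓝 0) := by
  refine congr_poly ?_ (tendsto_of_hasSum (periodic_eulerFn 4) (mdifferentiable_eulerFn 4)
    (isBoundedAtImInfty_eulerFn (by norm_num)) (hasSum_eulerFn (by norm_num)) 34)
  have h := coeff_formalEulerScaled_four_le_thirtyFour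
  simp only [Finset.sum_range_succ, Finset.sum_range_zero, h 0 (by norm_num), h 1 (by norm_num), h 2 (by norm_num), h 3 (by norm_num), h 4 (by norm_num), h 5 (by norm_num), h 6 (by norm_num), h 7 (by norm_num), h 8 (by norm_num), h 9 (by norm_num), h 10 (by norm_num), h 11 (by norm_num), h 12 (by norm_num), h 13 (by norm_num), h 14 (by norm_num), h 15 (by norm_num), h 16 (by norm_num), h 17 (by norm_num), h 18 (by norm_num), h 19 (by norm_num), h 20 (by norm_num), h 21 (by norm_num), h 22 (by norm_num), h 23 (by norm_num), h 24 (by norm_num), h 25 (by norm_num), h 26 (by norm_num), h 27 (by norm_num), h 28 (by norm_num), h 29 (by norm_num), h 30 (by norm_num), h 31 (by norm_num), h 32 (by norm_num), h 33 (by norm_num), h 34 (by norm_num)]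
  norm_num
  ring

/-- The `q`-coefficients `0, …, 34` of `E₈`. [folklore] -/
theorem coeff_formalEulerScaled_eight_le_thirtyFour (n : ℕ) (hn : n ≤ 34) :
    PowerSeries.coeff n (formalEulerScaled 8) = if n = 0 then 1 else if n = 8 then -1 else if n = 16 then -1 else 0 := by
  have h0 := coeff_formalEulerPow_one_le_seventeen 0 (by norm_num) 
  have h1 := coeff_formalEulerPow_one_le_seventeen 1 (by norm_num) 
  have h2 := coeff_formalEulerPow_one_le_seventeen 2 (by norm_num) 
  have h3 := coeff_formalEulerPow_one_le_seventeen 3 (by norm_num) 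
  have h4 := coeff_formalEulerPow_one_le_seventeen 4 (by norm_num)
  simp only at h0 h1 h2 h3 h4
  interval_cases n <;> simp +decide [coeff_formalEulerScaled, h0, h1, h2, h3, h4]

/-- **`E₈ = 1 - q ^ 8 - q ^ 16 + o(q³⁴)`.** [folklore] -/
theorem tendsto_eulerFn_eight_thirtyFour :
    Tendsto (fun τ : ℍ ↦ (eulerFn 8 τ - (1 - X ^ 8 - X ^ 16 : ℂ[X]).eval (Function.Periodic.qParam 1 (τ : ℂ)))
      / Function.Periodic.qParam 1 (τ : ℂ) ^ 34) atImInfty (𝓝 0) := by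
  refine congr_poly ?_ (tendsto_of_hasSum (periodic_eulerFn 8) (mdifferentiable_eulerFn 8)
    (isBoundedAtImInfty_eulerFn (by norm_num)) (hasSum_eulerFn (by norm_num)) 34)
  have h := coeff_formalEulerScaled_eight_le_thirtyFour
  simp only [Finset.sum_range_succ, Finset.sum_range_zero, h 0 (by norm_num), h 1 (by norm_num), h 2 (by norm_num), h 3 (by norm_num), h 4 (by norm_num), h 5 (by norm_num), h 6 (by norm_num), h 7 (by norm_num), h 8 (by norm_num), h 9 (by norm_num), h 10 (by norm_num), h 11 (by norm_num), h 12 (by norm_num), h 13 (by norm_num), h 14 (by norm_num), h 15 (by norm_num), h 16 (by norm_num), h 17 (by norm_num), h 18 (by norm_num), h 19 (by norm_num), h 20 (by norm_num), h 21 (by norm_num), h 22 (by norm_num), h 23 (by norm_num), h 24 (by norm_num), h 25 (by norm_num), h 26 (by norm_num), h 27 (by norm_num), h 28 (by norm_num), h 29 (by norm_num), h 30 (by norm_num), h 31 (by norm_num), h 32 (by norm_num), h 33 (by norm_num), h 34 (by norm_num)]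
  norm_num
  ring

/-- The `q`-coefficients `0, …, 34` of `E₁₄`. [folklore] -/
theorem coeff_formalEulerScaled_fourteen_le_thirtyFour (n : ℕ) (hn : n ≤ 34) :
    PowerSeries.coeff n (formalEulerScaled 14) = if n = 0 then 1 else if n = 14 then -1 else if n = 28 then -1 else 0 := by
  have h0 := coeff_formalEulerPow_one_le_seventeen 0 (by norm_num) 
  have h1 := coeff_formalEulerPow_one_le_seventeen 1 (by norm_num) 
  have h2 := coeff_formalEulerPow_one_le_seventeen 2 (by norm_num)
  simp only at h0 h1 h2
  interval_cases n <;> simp +decide [coeff_formalEulerScaled, h0, h1, h2]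

/-- **`E₁₄ = 1 - q ^ 14 - q ^ 28 + o(q³⁴)`.** [folklore] -/
theorem tendsto_eulerFn_fourteen_thirtyFour :
    Tendsto (fun τ : ℍ ↦ (eulerFn 14 τ - (1 - X ^ 14 - X ^ 28 : ℂ[X]).eval (Function.Periodic.qParam 1 (τ : ℂ)))
      / Function.Periodic.qParam 1 (τ : ℂ) ^ 34) atImInfty (𝓝 0) := by
  refine congr_poly ?_ (tendsto_of_hasSum (periodic_eulerFn 14) (mdifferentiable_eulerFn 14)
    (isBoundedAtImInfty_eulerFn (by norm_num)) (hasSum_eulerFn (by norm_num)) 34)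
  have h := coeff_formalEulerScaled_fourteen_le_thirtyFour
  simp only [Finset.sum_range_succ, Finset.sum_range_zero, h 0 (by norm_num), h 1 (by norm_num), h 2 (by norm_num), h 3 (by norm_num), h 4 (by norm_num), h 5 (by norm_num), h 6 (by norm_num), h 7 (by norm_num), h 8 (by norm_num), h 9 (by norm_num), h 10 (by norm_num), h 11 (by norm_num), h 12 (by norm_num), h 13 (by norm_num), h 14 (by norm_num), h 15 (by norm_num), h 16 (by norm_num), h 17 (by norm_num), h 18 (by norm_num), h 19 (by norm_num), h 20 (by norm_num), h 21 (by norm_num), h 22 (by norm_num), h 23 (by norm_num), h 24 (by norm_num), h 25 (by norm_num), h 26 (by norm_num), h 27 (by norm_num), h 28 (by norm_num), h 29 (by norm_num), h 30 (by norm_num), h 31 (by norm_num), h 32 (by norm_num), h 33 (by norm_num), h 34 (by norm_num)]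
  norm_num
  ring

/-- The `q`-coefficients `0, …, 34` of `E₂₈`. [folklore] -/
theorem coeff_formalEulerScaled_twentyEight_le_thirtyFour (n : ℕ) (hn : n ≤ 34) :
    PowerSeries.coeff n (formalEulerScaled 28) = if n = 0 then 1 else if n = 28 then -1 else 0 := by
  have h0 := coeff_formalEulerPow_one_le_seventeen 0 (by norm_num) 
  have h1 := coeff_formalEulerPow_one_le_seventeen 1 (by norm_num)
  simp only at h0 h1
  interval_cases n <;> simp +decide [coeff_formalEulerScaled, h0, h1]

/-- **`E₂₈ = 1 - q ^ 28 + o(q³⁴)`.** [folklore] -/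
theorem tendsto_eulerFn_twentyEight_thirtyFour :
    Tendsto (fun τ : ℍ ↦ (eulerFn 28 τ - (1 - X ^ 28 : ℂ[X]).eval (Function.Periodic.qParam 1 (τ : ℂ)))
      / Function.Periodic.qParam 1 (τ : ℂ) ^ 34) atImInfty (𝓝 0) := by
  refine congr_poly ?_ (tendsto_of_hasSum (periodic_eulerFn 28) (mdifferentiable_eulerFn 28)
    (isBoundedAtImInfty_eulerFn (by norm_num)) (hasSum_eulerFn (by norm_num)) 34)
  have h := coeff_formalEulerScaled_twentyEight_le_thirtyFour
  simp only [Finset.sum_range_succ, Finset.sum_range_zero, h 0 (by norm_num), h 1 (by norm_num), h 2 (by norm_num), h 3 (by norm_num), h 4 (by norm_num), h 5 (by norm_num), h 6 (by norm_num), h 7 (by norm_num), h 8 (by norm_num), h 9 (by norm_num), h 10 (by norm_num), h 11 (by norm_num), h 12 (by norm_num), h 13 (by norm_num), h 14 (by norm_num), h 15 (by norm_num), h 16 (by norm_num), h 17 (by norm_num), h 18 (by norm_num), h 19 (by norm_num), h 20 (by norm_num), h 21 (by norm_num), h 22 (by norm_num), h 23 (by norm_num), h 24 (by norm_num), h 25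 (by norm_num), h 26 (by norm_num), h 27 (by norm_num), h 28 (by norm_num), h 29 (by norm_num), h 30 (by norm_num), h 31 (by norm_num), h 32 (by norm_num), h 33 (by norm_num), h 34 (by norm_num)]
  norm_num
  ring

end Summit.BirchSwinnertonDyer.BirchSwinnertonDyer.Theorems.ManinLocalTwoThree.EulerRemaindersFiftySixB

end
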